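/-
Copyright: cell `pub-ymgap` (HUMAN RULING D-0062), Track A of `YM-PLAN.md`, DAG node N20 (= NE7b); R134 acceleration seat
`pub-ymgap-dag-n20-c` (strategy s1, generation 22), module 61.  Released under the licence of the surrounding project.
-/
import Summits.QuantumFields.YangMills.Theorems.BalabanUVNodesN20LCSThm1Crude
import HarnessLib

/-!
# YM-DAG node N20 (= NE7b), row s1, module 61: A2 WITH GAIN AT THE FIRST STEP — the letter-free class weight bound of module 60 §3 carries
# ONE PEIERLS FACTOR `θ` PER SKELETON CUBE, `θ ∈ (0,1]` ARBITRARY, for couplings below an EXPLICIT `γ(θ)` (numerics `r·d + 2 ≤ 2p₀`)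

Track A of `YM-PLAN.md` (cell `pub-ymgap`, HUMAN RULING D-0062), node **N20** = spine estimate NE7b (`T4WeightBudget.RelWeightBound`, NOT
PRINTED, NOT PROVED).  Seat `pub-ymgap-dag-n20-c` (R134, s1), generation 22, module 61.  Kernel theorems only: 0 `def`, 0 `sorry`, standard
axioms; COUNT-NEUTRAL.  Composition BY NAME of module 60 (`…N20LCSThm1Crude.sum_admS_integral_le_rec_rootedAtZero_crude`: keys rooted at step `0`,
arbitrary pinned family, NO letter of Bałaban's kind, rate `m₀·e^{Cδ₀ − δ₀g₀⁻²(ε₁∕B)²∕(2N)}` at any `B ≥ B₀`) and module 52 §2's asymptotics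
(`RkOfRecord_le_mul_pow`: `R(g) ≤ L·(log g⁻²)^r`).  Nothing is re-declared.

THE QUESTION (A2, reviewers' standing request).  Module 60 §3 is letter-free but its rate is an expression; is it ever `< 1` — is the level-`0` discharge
GAINFUL, and in which regime?  At `B = B₀(g₁) = √(N·n⋆₀)·L²`, `n⋆₀ = d²(9·L²M₂R₁)^d`, `R₁ = R(g₁) ≤ L·t^r`, `t = log g₁⁻²`, `ε₁ = g₁A₀t^{p₀}`, `g₀ ≤ g₁`:
`g₀⁻²(ε₁∕B₀)² ≥ A₀²t^{2p₀}∕(N·n⋆₀·L⁴) ≥ (A₀²∕(N·Q·L⁴))·t^{2p₀ − rd}`, `Q := d²(9L³M₂)^d`, and `log m₀ ≤ log Q + rd·t`; so for `2p₀ ≥ rd + 2` the exponent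
`κ·t^{2p₀−rd} ≥ κ·t²` (`κ = δ₀A₀²∕(2N²L⁴Q)`) beats `log Q + rd·t + Cδ₀ + log θ⁻¹` as soon as `t ≥ t₀ := max 1 ((log Q + Cδ₀ + log θ⁻¹ + rd)∕κ)`, i.e.
`g₁ ≤ γ(θ) := exp(−t₀∕2)`.

WHAT THIS FILE PROVES.
* §1 ★★ `rate0_le_of_le_gstar` — the real-analysis lemma: for `1 ≤ N′`, `0 < δ₀`, `0 ≤ C`, `0 < A₀`, `θ ∈ (0,1]`, `r·d + 2 ≤ 2p₀`, `1 ≤ d`, `2 ≤ L`, `1 ≤ M₂`,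
  `0 < g₀ ≤ g₁ ≤ γ(θ)`: `m₀(g₁)·exp(Cδ₀ − δ₀g₀⁻²((g₁p₀(g₁))∕(√(N′·n⋆₀(g₁))·L²))²∕(2N′)) ≤ θ`.
* §3 the letter `r·d + 2 ≤ 2p₀` located: `⇔ 2r + 1 ≤ p₀` at `d = 4`; FAILS at def-R's displayed defaults `r = p₀ = 1` (CAUTION-R‴; print's `p₀` is large).
* §2 ★★★ `sum_admS_integral_le_rec_rootedAtZero_gain` — module 60 §3 AT `B = B₀(g 1)` in the regime `0 < g₀ ≤ g 1 ≤ γ(θ)`: for EVERY pinned family `D` of χ₁-cubes,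
  `∃ n, #D ≤ 39^d·n ∧ (class weight of the label histories pinned at D, level Kc+1) ≤ θⁿ·∫ρ₀` — ONE PEIERLS FACTOR `θ` PER SKELETON CUBE, `θ` as small as wanted,
  NO letter of Bałaban's kind, numerics∕geometry letters only (`1 ≤ K`, `4N ≤ g₀⁻²`, `0 < M₂`, `1 ≤ M₁`, `LM₁ ∣ 2L^{m+K}`, `LM₁ ≤ sideχ₀`, `0 < A₀`, `r·d + 2 ≤ 2p₀`).

HONEST SCOPE.  Level `0` (keys rooted at the first step) only; `γ(θ)` is crude and NOT print's; the exponent inequality `r·d + 2 ≤ 2p₀` is a located numerics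
letter of THIS crude route (print's [Balaban1985Variational] Thm 1 (8) has a level- and coupling-uniform `B₃` and needs no such relation); nothing of
Bałaban's asserted; NE7b NOT PRINTED ∕ NOT PROVED; (α)-instance 0∕1; N20 NOT discharged; typed 28∕28, count untouched; one finite four-torus at fixed `ε` — NOT
ℝ⁴, NOT infinite volume, NOT OS, NOT a mass gap, NOT Clay.

References (LOCATORS): T. Bałaban, CMP 119 (1988) 243–285 [Balaban1988Convergent] ((2.4)–(2.5) p.255, (2.16)–(2.17) p.257, (3.2) p.265, (3.26)–(3.30)
pp.270–271); CMP 122 (1989) 175–202 [Balaban1989LargeFieldI] ((0.3)–(0.5) pp.176–177); CMP 102 (1985) 277–309 [Balaban1985Variational] (Thm 1 (8) p.279).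
-/

set_option autoImplicit false

noncomputable section

open scoped BigOperators

namespace Summit.QuantumFields.YangMills.BalabanUVNodes.N20LCSRootedAtZeroGain

open MeasureTheory
open Literature.MathematicalPhysics.QuantumFieldTheory.Balaban1983to89
open Literature.MathematicalPhysics.QuantumFieldTheory.Balaban1983to89.T4Continuum
open Literature.MathematicalPhysics.QuantumFieldTheory.Balaban1983to89.B14.Eq218Concrete
open Literature.MathematicalPhysics.QuantumFieldTheory.Balaban1983to89.Node00
open B15DeterminingSets B14.Eq213DetSet B14.Eq216Concrete B14.Eq213MaximalDomains B15Eq112TorusCover B14DomainGeom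
open Literature.MathematicalPhysics.QuantumFieldTheory.Balaban1983to89.B14SeparationOfRecord (one_le_RkOfRecord)
open Summit.QuantumFields.BalabanUV.T4Continuum.B16HistoryIndexedRepr (GoodClass)
open Summit.QuantumFields.BalabanUV.T4Continuum.B16HistoryReprChain
open Summit.QuantumFields.BalabanUV.T4Continuum.NE7b.PrefixExtraction (admS)
open Summit.QuantumFields.YangMills.BalabanUVNodes.N20LCSLabelTower
open Summit.QuantumFields.YangMills.BalabanUVNodes.N20LCSSmallCouplingRegime (RkOfRecord_le_mul_pow)
open Summit.QuantumFields.YangMills.BalabanUVNodes.N20LCSThm1Crude (sum_admS_integral_le_rec_rootedAtZero_crude)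

/-! ## §1  The level-0 rate at `B = B₀(g₁)` is below any `θ ∈ (0,1]` for couplings below an explicit `γ(θ)` -/

section Rate

/-- ★★ **THE LEVEL-0 RATE IS BELOW `θ` BELOW `γ(θ)`**: with `Q = d²(9L³M₂)^d`, `κ = δ₀A₀²∕(2N′²L⁴Q)`, `t₀ = max 1 ((log Q + Cδ₀ + log θ⁻¹ + rd)∕κ)`, `γ = e^{−t₀∕2}`:
for `0 < g₀ ≤ g₁ ≤ γ` the factor `m₀(g₁)·exp(Cδ₀ − δ₀g₀⁻²·((g₁p₀(g₁))∕(√(N′n⋆₀(g₁))·L²))²∕(2N′))` of module 60 §3 at `B = B₀(g₁)` is `≤ θ` (`t = log g₁⁻² ≥ t₀`;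
`R(g₁) ≤ L·t^r`; `m₀, n⋆₀ ≤ Q·t^{rd}`; exponent `≥ κ·t^{2p₀−rd} ≥ κ·t²`; `log m₀ ≤ log Q + rd·t`).  Numerics letter of the crude route: `r·d + 2 ≤ 2p₀`.
[cite: Balaban1988Convergent, (2.4)–(2.5) p.255, (2.17) p.257] -/
theorem rate0_le_of_le_gstar {N' δ₀ C A₀ θ : ℝ} {p₀ r d L M₂ : ℕ} (hN : 1 ≤ N') (hδ₀ : 0 < δ₀) (hC : 0 ≤ C) (hA : 0 < A₀)
    (hθ : 0 < θ) (hθ1 : θ ≤ 1) (hp : r * d + 2 ≤ 2 * p₀) (hd : 1 ≤ d) (hL : 2 ≤ L) (hM₂ : 1 ≤ M₂)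
    {g₀ g₁ : ℝ} (hg0 : 0 < g₀) (hg01 : g₀ ≤ g₁)
    (hg : g₁ ≤ Real.exp (-(max 1 ((Real.log ((d ^ 2 * (9 * L ^ 3 * M₂) ^ d : ℕ) : ℝ) + C * δ₀ + Real.log θ⁻¹ + ((r * d : ℕ) : ℝ)) /
        (δ₀ * A₀ ^ 2 / (2 * N' * N' * (L : ℝ) ^ 4 * ((d ^ 2 * (9 * L ^ 3 * M₂) ^ d : ℕ) : ℝ))))) / 2)) :
    ((d ^ 2 * (9 * (L * M₂ * RkOfRecord L r g₁)) ^ d : ℕ) : ℝ) *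
        Real.exp (C * δ₀ - δ₀ * g₀⁻¹ ^ 2 * (((g₁ * p0Profile A₀ p₀ g₁) /
          (Real.sqrt (N' * ((d ^ 2 * (9 * (L ^ 2 * M₂ * RkOfRecord L r g₁)) ^ d : ℕ) : ℝ)) * (L : ℝ) ^ 2)) ^ 2 / (2 * N'))) ≤ θ := by
  -- abbreviations
  set Q : ℝ := ((d ^ 2 * (9 * L ^ 3 * M₂) ^ d : ℕ) : ℝ) with hQ
  set κ : ℝ := δ₀ * A₀ ^ 2 / (2 * N' * N' * (L : ℝ) ^ 4 * Q) with hκ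
  set S : ℝ := Real.log Q + C * δ₀ + Real.log θ⁻¹ with hS
  set t₀ : ℝ := max 1 ((S + ((r * d : ℕ) : ℝ)) / κ) with ht₀
  set t : ℝ := Real.log (g₁ ^ 2)⁻¹ with ht
  set m : ℝ := ((d ^ 2 * (9 * (L * M₂ * RkOfRecord L r g₁)) ^ d : ℕ) : ℝ) with hm
  set n : ℝ := ((d ^ 2 * (9 * (L ^ 2 * M₂ * RkOfRecord L r g₁)) ^ d : ℕ) : ℝ) with hn
  have hg1 : 0 < g₁ := lt_of_lt_of_le hg0 hg01
  have hL1 : (1 : ℝ) ≤ L := by exact_mod_cast (by omega : 1 ≤ L)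
  have hL0 : (0 : ℝ) < L := by linarith
  have hQ1 : (1 : ℝ) ≤ Q := by
    have : 1 ≤ d ^ 2 * (9 * L ^ 3 * M₂) ^ d :=
      Nat.mul_pos (pow_pos (by omega) 2) (pow_pos (Nat.mul_pos (Nat.mul_pos (by norm_num) (pow_pos (by omega) 3)) (by omega)) _)
    rw [hQ]; exact_mod_cast this
  have hQ0 : 0 < Q := lt_of_lt_of_le one_pos hQ1
  have hN0 : 0 < N' := lt_of_lt_of_le one_pos hN
  have hκ0 : 0 < κ := by rw [hκ]; positivity
  have hS0 : 0 ≤ S := by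
    have h1 : 0 ≤ Real.log Q := Real.log_nonneg hQ1
    have h2 : 0 ≤ Real.log θ⁻¹ := Real.log_nonneg (one_le_inv_iff₀.2 ⟨hθ, hθ1⟩)
    rw [hS]; positivity
  have ht₀1 : 1 ≤ t₀ := le_max_left _ _
  have hSκ : S + ((r * d : ℕ) : ℝ) ≤ κ * t₀ := by
    have h : (S + ((r * d : ℕ) : ℝ)) / κ ≤ t₀ := le_max_right _ _
    calc S + ((r * d : ℕ) : ℝ) ≤ t₀ * κ := (div_le_iff₀ hκ0).1 h
      _ = κ * t₀ := mul_comm _ _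
  -- `t ≥ t₀ ≥ 1`
  have htt₀ : t₀ ≤ t := by
    have h1 : g₁ ^ 2 ≤ Real.exp (-t₀) := by
      have h2 : g₁ ^ 2 ≤ Real.exp (-t₀ / 2) ^ 2 := pow_le_pow_left₀ hg1.le hg 2
      rwa [← Real.exp_nat_mul, show ((2 : ℕ) : ℝ) * (-t₀ / 2) = -t₀ by push_cast; ring] at h2
    have h3 : Real.exp t₀ ≤ (g₁ ^ 2)⁻¹ := by
      rw [le_inv_comm₀ (Real.exp_pos _) (by positivity), ← Real.exp_neg]
      exact h1
    rw [ht]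
    exact (Real.le_log_iff_exp_le (by positivity)).2 h3
  have ht1 : 1 ≤ t := ht₀1.trans htt₀
  have ht0 : 0 < t := lt_of_lt_of_le one_pos ht1
  -- `R(g₁) ≤ L·t^r`, `m ≤ Q t^{rd}`, `n ≤ Q t^{rd}`, `1 ≤ m`, `1 ≤ n`
  have htr : 1 ≤ t ^ r := one_le_pow₀ ht1
  have hR : (RkOfRecord L r g₁ : ℝ) ≤ L * t ^ r := RkOfRecord_le_mul_pow hL r htr
  have hR1 : 1 ≤ RkOfRecord L r g₁ := one_le_RkOfRecord (by omega) _ _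
  have hmQ : m ≤ Q * t ^ (r * d) := by
    rw [hm, hQ]; push_cast
    rw [pow_mul, mul_assoc ((d : ℝ) ^ 2), ← mul_pow]
    refine mul_le_mul_of_nonneg_left (pow_le_pow_left₀ (by positivity) ?_ d) (by positivity)
    calc (9 : ℝ) * ((L : ℝ) * M₂ * RkOfRecord L r g₁) ≤ 9 * ((L : ℝ) * M₂ * (L * t ^ r)) :=
          mul_le_mul_of_nonneg_left (mul_le_mul_of_nonneg_left hR (by positivity)) (by norm_num)
      _ = 9 * (L : ℝ) ^ 2 * M₂ * t ^ r := by ring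
      _ ≤ 9 * (L : ℝ) ^ 3 * M₂ * t ^ r := by
          have hL23 : (L : ℝ) ^ 2 ≤ (L : ℝ) ^ 3 := pow_le_pow_right₀ hL1 (by norm_num)
          have : 0 ≤ (9 : ℝ) * M₂ * t ^ r := by positivity
          nlinarith
  have hnQ : n ≤ Q * t ^ (r * d) := by
    rw [hn, hQ]; push_cast
    rw [pow_mul, mul_assoc ((d : ℝ) ^ 2), ← mul_pow]
    refine mul_le_mul_of_nonneg_left (pow_le_pow_left₀ (by positivity) ?_ d) (by positivity)
    calc (9 : ℝ) * ((L : ℝ) ^ 2 * M₂ * RkOfRecord L r g₁) ≤ 9 * ((L : ℝ) ^ 2 * M₂ * (L * t ^ r)) :=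
          mul_le_mul_of_nonneg_left (mul_le_mul_of_nonneg_left hR (by positivity)) (by norm_num)
      _ = 9 * (L : ℝ) ^ 3 * M₂ * t ^ r := by ring
  have hm1 : 1 ≤ m := by
    have : 1 ≤ d ^ 2 * (9 * (L * M₂ * RkOfRecord L r g₁)) ^ d :=
      Nat.mul_pos (pow_pos (by omega) 2) (pow_pos (Nat.mul_pos (by norm_num) (Nat.mul_pos (Nat.mul_pos (by omega) (by omega)) hR1)) _)
    rw [hm]; exact_mod_cast this
  have hn1 : 1 ≤ n := by
    have : 1 ≤ d ^ 2 * (9 * (L ^ 2 * M₂ * RkOfRecord L r g₁)) ^ d :=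
      Nat.mul_pos (pow_pos (by omega) 2) (pow_pos (Nat.mul_pos (by norm_num) (Nat.mul_pos (Nat.mul_pos (pow_pos (by omega) 2) (by omega)) hR1)) _)
    rw [hn]; exact_mod_cast this
  have hn0 : 0 < n := lt_of_lt_of_le one_pos hn1
  have htrd : 0 < t ^ (r * d) := pow_pos ht0 _
  -- the exponent: `δ₀ g₀⁻² (ε₁/B)²/(2N') ≥ κ t^{2p₀ − rd} ≥ κ t²`
  have hB2 : (Real.sqrt (N' * n) * (L : ℝ) ^ 2) ^ 2 = N' * n * (L : ℝ) ^ 4 := by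
    rw [mul_pow, Real.sq_sqrt (by positivity)]; ring
  have hprof : (g₁ * p0Profile A₀ p₀ g₁) ^ 2 = g₁ ^ 2 * (A₀ ^ 2 * t ^ (2 * p₀)) := by
    unfold p0Profile; rw [← ht, mul_pow, mul_pow, ← pow_mul, mul_comm p₀ 2]
  obtain ⟨e, he⟩ : ∃ e : ℕ, 2 * p₀ = r * d + e ∧ 2 ≤ e := ⟨2 * p₀ - r * d, by omega, by omega⟩
  have hexp : κ * t ^ 2 ≤ δ₀ * g₀⁻¹ ^ 2 * (((g₁ * p0Profile A₀ p₀ g₁) / (Real.sqrt (N' * n) * (L : ℝ) ^ 2)) ^ 2 / (2 * N')) := by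
    rw [div_pow, hB2, hprof, he.1, pow_add]
    -- `g₀⁻² g₁² ≥ 1`
    have hg2 : 1 ≤ g₀⁻¹ ^ 2 * g₁ ^ 2 := by
      rw [inv_pow, ← div_eq_inv_mul, one_le_div (by positivity)]
      exact pow_le_pow_left₀ hg0.le hg01 2
    have hte : t ^ 2 ≤ t ^ e := pow_le_pow_right₀ ht1 he.2
    -- κ t² ≤ κ t^e = δ₀ A₀² t^e /(2N'N'L⁴Q) ≤ δ₀ A₀² t^{rd} t^e /(2N' · N' n L⁴)  [n ≤ Q t^{rd}]
    have h1 : κ * t ^ 2 ≤ κ * t ^ e := mul_le_mul_of_nonneg_left hte hκ0.le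
    have h2 : κ * t ^ e = δ₀ * (A₀ ^ 2 * t ^ e) / (2 * N' * N' * (L : ℝ) ^ 4 * Q) := by rw [hκ]; ring
    have h3 : δ₀ * (A₀ ^ 2 * t ^ e) / (2 * N' * N' * (L : ℝ) ^ 4 * Q) ≤
        δ₀ * (A₀ ^ 2 * (t ^ (r * d) * t ^ e)) / (2 * N' * (N' * n * (L : ℝ) ^ 4)) := by
      rw [div_le_div_iff₀ (by positivity) (by positivity)]
      have : N' * n * (L : ℝ) ^ 4 ≤ N' * (Q * t ^ (r * d)) * (L : ℝ) ^ 4 := by gcongr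
      calc δ₀ * (A₀ ^ 2 * t ^ e) * (2 * N' * (N' * n * (L : ℝ) ^ 4))
          ≤ δ₀ * (A₀ ^ 2 * t ^ e) * (2 * N' * (N' * (Q * t ^ (r * d)) * (L : ℝ) ^ 4)) := by gcongr
        _ = δ₀ * (A₀ ^ 2 * (t ^ (r * d) * t ^ e)) * (2 * N' * N' * (L : ℝ) ^ 4 * Q) := by ring
    have h4 : δ₀ * (A₀ ^ 2 * (t ^ (r * d) * t ^ e)) / (2 * N' * (N' * n * (L : ℝ) ^ 4)) ≤
        δ₀ * g₀⁻¹ ^ 2 * (g₁ ^ 2 * (A₀ ^ 2 * (t ^ (r * d) * t ^ e)) / (N' * n * (L : ℝ) ^ 4) / (2 * N')) := by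
      rw [show δ₀ * g₀⁻¹ ^ 2 * (g₁ ^ 2 * (A₀ ^ 2 * (t ^ (r * d) * t ^ e)) / (N' * n * (L : ℝ) ^ 4) / (2 * N')) =
        (g₀⁻¹ ^ 2 * g₁ ^ 2) * (δ₀ * (A₀ ^ 2 * (t ^ (r * d) * t ^ e)) / (2 * N' * (N' * n * (L : ℝ) ^ 4))) by
          field_simp]
      exact le_mul_of_one_le_left (by positivity) hg2
    linarith
  -- `log m ≤ log Q + rd·t`
  have hlogm : Real.log m ≤ Real.log Q + ((r * d : ℕ) : ℝ) * t := by
    have h1 : Real.log m ≤ Real.log (Q * t ^ (r * d)) := Real.log_le_log (lt_of_lt_of_le one_pos hm1) hmQ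
    have h2 : Real.log (Q * t ^ (r * d)) = Real.log Q + ((r * d : ℕ) : ℝ) * Real.log t := by
      rw [Real.log_mul (by positivity) (by positivity), Real.log_pow]
    have h3 : Real.log t ≤ t := (Real.log_le_sub_one_of_pos ht0).trans (by linarith)
    rw [h2] at h1
    have h5 := mul_le_mul_of_nonneg_left h3 (Nat.cast_nonneg (α := ℝ) (r * d))
    linarith
  -- assemble: `log m + Cδ₀ − exponent ≤ log Q + rd t + C δ₀ − κ t² ≤ log θ`
  have hkey : Real.log Q + ((r * d : ℕ) : ℝ) * t + C * δ₀ - κ * t ^ 2 ≤ Real.log θ := by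
    have h1 : (S + ((r * d : ℕ) : ℝ)) * t ≤ κ * t ^ 2 := by
      have h11 : (S + ((r * d : ℕ) : ℝ)) * t ≤ κ * t₀ * t := mul_le_mul_of_nonneg_right hSκ ht0.le
      have h12 : κ * t₀ * t ≤ κ * t * t := mul_le_mul_of_nonneg_right (mul_le_mul_of_nonneg_left htt₀ hκ0.le) ht0.le
      have h13 : κ * t * t = κ * t ^ 2 := by ring
      linarith only [h11, h12, h13]
    have h2 : S + ((r * d : ℕ) : ℝ) * t ≤ (S + ((r * d : ℕ) : ℝ)) * t := by
      have h21 : S * 1 ≤ S * t := mul_le_mul_of_nonneg_left ht1 hS0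
      have h22 : (S + ((r * d : ℕ) : ℝ)) * t = S * t + ((r * d : ℕ) : ℝ) * t := by ring
      linarith only [h21, h22]
    have h3 : Real.log θ⁻¹ = -Real.log θ := Real.log_inv θ
    have h4 : S = Real.log Q + C * δ₀ - Real.log θ := by rw [hS, h3]; ring
    linarith only [h1, h2, h4]
  have hpos : 0 < m * Real.exp (C * δ₀ - δ₀ * g₀⁻¹ ^ 2 * (((g₁ * p0Profile A₀ p₀ g₁) /
      (Real.sqrt (N' * n) * (L : ℝ) ^ 2)) ^ 2 / (2 * N'))) := by positivity
  rw [← Real.log_le_log_iff hpos hθ, Real.log_mul (by positivity) (Real.exp_pos _).ne', Real.log_exp]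
  linarith only [hkey, hlogm, hexp]

end Rate

/-! ## §2  Keys rooted at the first step: ONE PEIERLS FACTOR `θ` PER SKELETON CUBE below `γ(θ)`, no letter of Bałaban's kind -/

section Gain

variable (F : T4Family) (N : ℕ) [NeZero N] (ν : Stage7Numerics) (M : ℕ) (p : B12.RunParams) (g : ℕ → ℝ)

open Classical in
/-- ★★★ **THE GAINFUL LETTER-FREE CLASS WEIGHT BOUND AT THE FIRST STEP.**  For every `θ ∈ (0, 1]` there is the explicit `γ(θ) > 0` of §1 such that, in the
regime `0 < g₀ ≤ g 1 ≤ γ(θ)` (and `4N ≤ g₀⁻²`), for EVERY family `D` of χ₁-cubes and every label pattern `E` pinning `D` at step `0`: the label histories of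
length `Kc + 1` weigh at level `Kc + 1` at most `θⁿ·∫ρ₀ dU₀` for some `n` with `#D ≤ 39^d·n` — module 60 §3 at `B := B₀(g 1) = √(N·n⋆₀)·L²` and §1.  Letters:
numerics∕geometry only (`1 ≤ K`, `0 < M₂`, `1 ≤ M₁`, `LM₁ ∣ 2L^{m+K}`, `LM₁ ≤ sideχ₀`, `0 < A₀`, `r·d + 2 ≤ 2p₀`); NOTHING of [Balaban1985Variational]'s or the
cluster expansion's kind.  LOCATED: level `0` only; `γ(θ)` crude. [cite: Balaban1988Convergent, (3.2) p.265, (3.26)–(3.30) pp.270–271; Balaban1989LargeFieldI, (0.3)–(0.5) pp.176–177] -/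
theorem sum_admS_integral_le_rec_rootedAtZero_gain (hA : 0 < ν.A₀) (hp : ν.r * (F.P p.K).d + 2 ≤ 2 * ν.p₀) (hM₂ : 0 < ν.M₂) (hM₁ : 1 ≤ ν.M₁)
    (hK : 1 ≤ p.K) (hdiv : side (F.P p.K).L ν.M₁ 1 ∣ (F.P p.K).sitesPerDir 0) {θ : ℝ} (hθ : 0 < θ) (hθ1 : θ ≤ 1) :
    ∃ δ₀ : ℝ, 0 < δ₀ ∧ ∃ C : ℝ, 0 ≤ C ∧ ∀ (g₀ E₀ : ℝ), 0 < g₀ → 4 * N ≤ g₀⁻¹ ^ 2 → g₀ ≤ g 1 →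
      g 1 ≤ Real.exp (-(max 1 ((Real.log (((F.P p.K).d ^ 2 * (9 * (F.P p.K).L ^ 3 * ν.M₂) ^ (F.P p.K).d : ℕ) : ℝ) + C * δ₀ + Real.log θ⁻¹ +
          ((ν.r * (F.P p.K).d : ℕ) : ℝ)) /
        (δ₀ * ν.A₀ ^ 2 / (2 * (Fintype.card (Fin N) : ℝ) * (Fintype.card (Fin N) : ℝ) * ((F.P p.K).L : ℝ) ^ 4 *
          (((F.P p.K).d ^ 2 * (9 * (F.P p.K).L ^ 3 * ν.M₂) ^ (F.P p.K).d : ℕ) : ℝ))))) / 2) →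
      side (F.P p.K).L ν.M₁ 1 ≤ sideχ F ν p g 0 →
      ∀ (A₁ : ℝ) (D : Finset (Iχ F ν p g 0)) (Kc : ℕ) (E : (j : ℕ) → (Fin j → LabelPat F ν p g) → Finset (LbOfRecord F ν p g j)),
        (∀ h t, t ∈ E 0 h → D ⊆ t.1) →
        ∃ n : ℕ, D.card ≤ 39 ^ (F.P p.K).d * n ∧
          ∑ h ∈ admS (labelTowerOfRecord F N ν M p g A₁ (zeta316OfRecord F N ν M A₁)) (labelPattern F ν p g E) (Kc + 1),
              ∫ x, (labelTowerOfRecord F N ν M p g A₁ (zeta316OfRecord F N ν M A₁)).eterm (rhoZeroOfRecord F N p.K g₀ E₀) (Kc + 1) h x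
                ∂(lawOfRecord F N p.K (Kc + 1)) ≤
            θ ^ n * ∫ x, rhoZeroOfRecord F N p.K g₀ E₀ x ∂(fieldMeasure (F.P p.K) 0 (SU N)) := by
  obtain ⟨δ₀, hδ₀, C, hC, h60⟩ := sum_admS_integral_le_rec_rootedAtZero_crude F N ν M p g
  refine ⟨δ₀, hδ₀, C, hC, ?_⟩
  intro g₀ E₀ hg0 hg4 hg01 hγ hsz A₁ D Kc E hE0
  have hm : 1 ≤ (F.P p.K).m + (F.P p.K).K := by
    have := F.hm
    simp only [T4Family.P_m, T4Family.P_K]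
    omega
  have hg1 : 0 < g 1 := lt_of_lt_of_le hg0 hg01
  have hN1 : (1 : ℝ) ≤ (Fintype.card (Fin N) : ℝ) := by
    rw [Fintype.card_fin]; exact_mod_cast Nat.one_le_iff_ne_zero.2 (NeZero.ne N)
  have hL2 : 2 ≤ (F.P p.K).L := (F.P p.K).hL.2
  -- `n⋆₀` at the χ₁-cubes: `sideχ 0 = L²·M₂·R(g 1)`
  have hside : sideχ F ν p g 0 = (F.P p.K).L ^ 2 * ν.M₂ * RkOfRecord (F.P p.K).L ν.r (g (0 + 1)) := by
    unfold sideχ cubeSide; ring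
  have hn1 : 1 ≤ (F.P p.K).d ^ 2 * (9 * sideχ F ν p g 0) ^ (F.P p.K).d := by
    have hs : 1 ≤ sideχ F ν p g 0 := by
      rw [hside]
      exact Nat.one_le_iff_ne_zero.2 (Nat.mul_ne_zero (Nat.mul_ne_zero (pow_ne_zero _ (F.P p.K).L_pos.ne') (by omega))
        (by have := one_le_RkOfRecord (F.P p.K).L_pos ν.r (g (0 + 1)); omega))
    exact Nat.one_le_iff_ne_zero.2 (Nat.mul_ne_zero (pow_ne_zero _ (by have := (F.P p.K).hd; omega))
      (pow_ne_zero _ (by omega)))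
  -- the choice `B := √(N·n⋆₀)·L²`, so that `B·η₁² = √(N·n⋆₀)`
  set B : ℝ := Real.sqrt ((N : ℝ) * (((F.P p.K).d ^ 2 * (9 * sideχ F ν p g 0) ^ (F.P p.K).d : ℕ) : ℝ)) * ((F.P p.K).L : ℝ) ^ 2 with hBdef
  have hL0 : (0 : ℝ) < (F.P p.K).L := by exact_mod_cast (F.P p.K).L_pos
  have hsqrt : 0 < Real.sqrt ((N : ℝ) * (((F.P p.K).d ^ 2 * (9 * sideχ F ν p g 0) ^ (F.P p.K).d : ℕ) : ℝ)) := by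
    apply Real.sqrt_pos.2
    have hN' : (0 : ℝ) < N := by exact_mod_cast Nat.pos_of_ne_zero (NeZero.ne N)
    have : (1 : ℝ) ≤ (((F.P p.K).d ^ 2 * (9 * sideχ F ν p g 0) ^ (F.P p.K).d : ℕ) : ℝ) := by exact_mod_cast hn1
    positivity
  have hB0 : 0 < B := by rw [hBdef]; positivity
  have hBη : Real.sqrt ((N : ℝ) * (((F.P p.K).d ^ 2 * (9 * sideχ F ν p g 0) ^ (F.P p.K).d : ℕ) : ℝ)) ≤ B * (F.P p.K).eta 1 ^ 2 := by
    rw [hBdef]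
    unfold Params.eta
    rw [pow_one, inv_pow, mul_assoc, mul_inv_cancel₀ (by positivity), mul_one]
  have hε1 : 0 < epsOfRecord ν g 1 := by
    unfold epsOfRecord p0Profile
    have ht : 0 < Real.log ((g 1) ^ 2)⁻¹ := by
      apply Real.log_pos
      have h1 : g 1 < 1 := by
        refine hγ.trans_lt ((Real.exp_lt_exp.2 ?_).trans_eq Real.exp_zero)
        exact div_neg_of_neg_of_pos (neg_neg_of_pos (lt_max_of_lt_left one_pos)) two_pos
      have h2 : (g 1) ^ 2 < 1 := by nlinarith
      exact one_lt_inv_iff₀.2 ⟨by positivity, h2⟩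
    positivity
  obtain ⟨n, hn, hle⟩ := h60 hK g₀ E₀ hg4 A₁ hM₂ hM₁ hm hdiv hsz B hB0 hε1 hBη D Kc E hE0
  refine ⟨n, hn, hle.trans (mul_le_mul_of_nonneg_right (pow_le_pow_left₀ (by positivity) ?_ n) ?_)⟩
  · -- the rate at `B = B₀(g 1)` is `≤ θ` (§1 with `N′ := card (Fin N) = N`, `g₁ := g 1`)
    have hcard : (Fintype.card (Fin N) : ℝ) = N := by rw [Fintype.card_fin]
    have key := rate0_le_of_le_gstar (N' := (Fintype.card (Fin N) : ℝ)) (δ₀ := δ₀) (C := C) (A₀ := ν.A₀) (θ := θ)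
      (p₀ := ν.p₀) (r := ν.r) (d := (F.P p.K).d) (L := (F.P p.K).L) (M₂ := ν.M₂) hN1 hδ₀ hC hA hθ hθ1 hp (F.P p.K).hd hL2 hM₂
      (g₀ := g₀) (g₁ := g 1) hg0 hg01 hγ
    have hside' : (((F.P p.K).d ^ 2 * (9 * sideχ F ν p g 0) ^ (F.P p.K).d : ℕ) : ℝ) =
        (((F.P p.K).d ^ 2 * (9 * ((F.P p.K).L ^ 2 * ν.M₂ * RkOfRecord (F.P p.K).L ν.r (g 1))) ^ (F.P p.K).d : ℕ) : ℝ) := by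
      rw [hside]
    have hε : epsOfRecord ν g 1 = g 1 * p0Profile ν.A₀ ν.p₀ (g 1) := rfl
    rw [hε, hBdef, hside', ← hcard]
    convert key using 3
  · exact integral_nonneg fun U => (rhoZeroOfRecord_pos F N p.K g₀ E₀ U).le

end Gain

/-! ## §3  The numerics letter `r·d + 2 ≤ 2p₀` of the crude route, located (d = 4) -/

section Letter

/-- At `d = 4` the exponent letter of §1–§2 reads `2r + 1 ≤ p₀`. [cite: Balaban1988Convergent, (2.4)–(2.5) p.255 (bookkeeping)] -/
theorem exponent_letter_iff (r p₀ : ℕ) : r * 4 + 2 ≤ 2 * p₀ ↔ 2 * r + 1 ≤ p₀ := by omega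

/-- **CAUTION-R‴ (located numerics, as module 43's `M ≫ M₂`)**: at def-R's DISPLAYED DEFAULTS `r = p₀ = 1` (`Node00.numerics7OfRecord₁₂`, not imported here to stay
out of the `Record12Numerics` cone) the letter FAILS (`1·4 + 2 > 2·1`), so §2 is EMPTY at the record's defaults; print takes `p₀` *«a sufficiently large integer»*
([III] p.255), where it holds (`p₀ ≥ 2r + 1`).  A numerics pen re-pinning `p₀` removes the caution; [Balaban1985Variational] Thm 1 (8)'s uniform `B₃` needs no such
letter at all. [cite: Balaban1988Convergent, (2.4)–(2.5) p.255] -/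
theorem not_exponent_letter_at_defaults : ¬ ((1 : ℕ) * 4 + 2 ≤ 2 * 1) := by decide

/-- … and the letter holds as soon as `p₀ ≥ 2r + 1`, e.g. `r = 1`, `p₀ = 3`. [cite: Balaban1988Convergent, (2.4)–(2.5) p.255 (bookkeeping)] -/
theorem exponent_letter_of_le {r p₀ : ℕ} (h : 2 * r + 1 ≤ p₀) : r * 4 + 2 ≤ 2 * p₀ := by omega

end Letter

end Summit.QuantumFields.YangMills.BalabanUVNodes.N20LCSRootedAtZeroGain

end
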